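import Literature.Probability.Percolation.RSWProofs
import Literature.Probability.Percolation.PlanarDuality
import Literature.Probability.Percolation.RadialCrossingDuality
import Literature.Probability.Percolation.CrossingChains
import Literature.Probability.Percolation.FourArmGarbanDocking
import Literature.Probability.Percolation.LatticeSymmetry
import Literature.Probability.Percolation.LatticeTraceGeometry
import Literature.Probability.LatticeModels.FKIsingWiredRectDuality
import HarnessLib

/-!
# Crux `StripClusterRates` (stmt-CriticalPhenomena-13878), line two-cluster-rate-is-stationary-gap, reshape 5 (lead c6):
registered stub `stub_cgTwoCluster`

Support file (`--supports stmt-CriticalPhenomena-13878`). See the skeleton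
`Cruxes/StripClusterRates/Lines/two_cluster_rate_is_stationary_gap.lean`, section `ConfinedGluing`, for the role of this stub in
the confined-gluing order transfer (γ₂-half of the crux from Cardy-order two-cluster Kac).

Proof outline.  The two confined long crossings (inside `cgBot`, `cgTop ⊆ [0,M]×[0,3b+2]`) are
the two left-right crossings.  If their left endpoints were joined inside the rectangle, then —
since the initial segment of the bottom crossing up to the column `b` stays in the square
`[0,b]²`, where it meets the open top-bottom fence of that square, and likewise at the top in
`[0,b]×[2b+2,3b+2]` — the bottom side of the rectangle would be joined to its top side: an open
top-bottom crossing of `[0,M]×[0,3b+2]`.  By planar duality in the transposed orientation (double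
duality `map_sub_one_mem_dualConfig_dualConfig` and the rectangle duality
`not_lrCrossingAt_of_dualConfig_tbCrossingAt`) this excludes the dual-open left-right crossing of
the faces `[-1,M]×[0,3b+1]` provided by the decreasing confined event.
-/

noncomputable section

open MeasureTheory Filter Topology Set
open Literature.Probability.LatticeModels Literature.Probability.Percolation

namespace Summit.CriticalPhenomena.CardyFormulaZ2.Cruxes.StripClusterRates.TwoClusterRateIsStationaryGap

/-- **Transposed rectangle duality**: an open top-bottom crossing of `[0,M]×[0,n+1]` excludes a
dual-open left-right crossing of the faces `(-1,0) + [0,M+1]×[0,n]`.  Proof: translated by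
`-(1,1)`, the open crossing is open in the dual of the dual configuration (double duality) and is
a top-bottom crossing of the dual rectangle `(-1,0) + ([0,M]×[-1,n])` of the face rectangle,
which by the rectangle duality lemma excludes the left-right crossing of the latter.
[cite: BollobasRiordan2006, Ch. 3, Lemma 1] -/
theorem cg_tb_dualLR_false {M n : ℕ} {ω : BondConfig (Site 2)} (hω : ω ⊆ (zdGraph 2).edgeSet)
    (h₁ : ω ∈ tbCrossing M (n + 1)) (h₂ : dualConfig ω ∈ lrCrossingAt (pt (-1) 0) (M + 1) n) :
    False := by
  classical
  have hωd : dualConfig ω ⊆ (zdGraph 2).edgeSet := fun _ he => (mem_dualConfig_iff.1 he).1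
  obtain ⟨s, hs, t, ht, hst⟩ := h₁
  obtain ⟨p, hpS, hpω⟩ := exists_walk_of_mem_openConnIn hω hst
  have hs' := Finset.mem_filter.1 (Finset.mem_coe.1 hs)
  have ht' := Finset.mem_filter.1 (Finset.mem_coe.1 ht)
  have hs'' := mem_rectangle_iff.1 hs'.1
  have ht'' := mem_rectangle_iff.1 ht'.1
  refine not_lrCrossingAt_of_dualConfig_tbCrossingAt (M + 1) n (pt (-1) 0) hωd ?_ h₂
  rw [openCrossing_comm]
  -- the crossing translated by `-(1,1)`
  set q : (zdGraph 2).Walk (s - 1) (t - 1) :=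
    (p.map (zdShiftIso (-1 : Site 2)).toHom).copy (sub_eq_add_neg s 1).symm (sub_eq_add_neg t 1).symm
    with hq
  refine ⟨s - 1, ?_, t - 1, ?_, mem_openConnIn_of_walk q (fun z hz => ?_) (fun e he => ?_)⟩
  · rw [mem_image_add_dualBottomSide]
    simp only [Pi.sub_apply, Pi.one_apply, pt, Matrix.cons_val_zero, Matrix.cons_val_one]
    push_cast
    omega
  · rw [mem_image_add_dualTopSide]
    simp only [Pi.sub_apply, Pi.one_apply, pt, Matrix.cons_val_zero, Matrix.cons_val_one]
    push_cast
    omega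
  · rw [hq, SimpleGraph.Walk.support_copy, SimpleGraph.Walk.support_map, List.mem_map] at hz
    obtain ⟨z₀, hz₀, rfl⟩ := hz
    have hz₀' := mem_rectangle_iff.1 (Finset.mem_coe.1 (hpS z₀ hz₀))
    show z₀ + -1 ∈ _
    rw [mem_image_add_dualRectangle]
    simp only [Pi.add_apply, Pi.neg_apply, Pi.one_apply, pt, Matrix.cons_val_zero,
      Matrix.cons_val_one]
    push_cast
    omega
  · rw [hq, SimpleGraph.Walk.edges_copy, SimpleGraph.Walk.edges_map, List.mem_map] at he
    obtain ⟨e₀, he₀, rfl⟩ := he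
    have hmap : Sym2.map ((zdShiftIso (-1 : Site 2)).toHom) e₀ = e₀.map fun x => x - 1 := by
      refine congrArg (fun f => Sym2.map f e₀) ?_
      funext x
      show x + -1 = x - 1
      rw [sub_eq_add_neg]
    rw [show (⇑(zdShiftIso (-1 : Site 2)).toHom : Site 2 → Site 2) = ⇑(zdShiftIso (-1 : Site 2)) from rfl]
      at *
    rw [hmap]
    exact map_sub_one_mem_dualConfig_dualConfig hω (hpω e₀ he₀)

/-- **CG1 · the end-confined three-arm structure has two spanning clusters** (registered stub `stub_cgTwoCluster` of crux `StripClusterRates`, line two-cluster-rate-is-stationary-gap, reshape 5): on lattice configurations, the increasing confined event (two confined open long crossings of `[0,M]×[0,3b+2]` + the two left fences) together with the decreasing one (a confined dual-open long crossing of faces) forces two open left-right crossings of the rectangle that are not joined inside it — a joining path would join the bottom side to the top side, which the dual left-right crossing forbids (planar duality transposed by double duality). [folklore; cite: GrimmettPercolation1999, §11.2; BollobasRiordan2006, Ch. 3, Lemma 1] -/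
theorem stub_cgTwoCluster :
    ∀ (M b : ℕ), 1 ≤ b → b + 1 ≤ M → ∀ ω : BondConfig (Site 2), ω ⊆ (zdGraph 2).edgeSet → ω ∈ (openCrossing {z ∈ (rectangle M (3 * b + 2) : Set (Site 2)) | (z 0 ≤ (b : ℤ) ∨ (M : ℤ) ≤ z 0 + b) → z 1 ≤ (b : ℤ)} (leftSide M (3 * b + 2) : Set (Site 2)) (rightSide M (3 * b + 2) : Set (Site 2)) ∩ tbCrossing b b ∩ openCrossing {z ∈ (rectangle M (3 * b + 2) : Set (Site 2)) | (z 0 ≤ (b : ℤ) ∨ (M : ℤ) ≤ z 0 + b) → 2 * (b : ℤ) + 2 ≤ z 1} (leftSide M (3 * b + 2) : Set (Site 2)) (rightSide M (3 * b + 2) : Set (Site 2)) ∩ (BondConfig.relabel (sym2Equiv (Site.shift (-pt 0 (2 * (b : ℤ) + 2))))) ⁻¹' tbCrossing b b) → ω ∈ (dualConfig ⁻¹' openCrossing {z ∈ ((· + pt (-1) 0) '' (rectangle (M + 1) (3 * b + 1) : Set (Site 2))) | (z 0 ≤ (b : ℤ) ∨ (M : ℤ) ≤ z 0 + b) → (b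 : ℤ) + 1 ≤ z 1 ∧ z 1 ≤ 2 * (b : ℤ)} ((· + pt (-1) 0) '' (leftSide (M + 1) (3 * b + 1) : Set (Site 2))) ((· + pt (-1) 0) '' (rightSide (M + 1) (3 * b + 1) : Set (Site 2)))) → ∃ x₁ ∈ (leftSide M (3 * b + 2) : Set (Site 2)), ∃ y₁ ∈ (rightSide M (3 * b + 2) : Set (Site 2)), ∃ x₂ ∈ (leftSide M (3 * b + 2) : Set (Site 2)), ∃ y₂ ∈ (rightSide M (3 * b + 2) : Set (Site 2)), ω ∈ openConnIn (rectangle M (3 * b + 2) : Set (Site 2)) x₁ y₁ ∧ ω ∈ openConnIn (rectangle M (3 * b + 2) : Set (Site 2)) x₂ y₂ ∧ ω ∉ openConnIn (rectangle M (3 * b + 2) : Set (Site 2)) x₁ x₂ := by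
  classical
  intro M b hb hbM ω hω hF hFm
  obtain ⟨⟨⟨hBot, hTB⟩, hTop⟩, hTB'⟩ := hF
  -- (1) the two long crossings
  obtain ⟨x₁, hx₁, y₁, hy₁, h₁⟩ := hBot
  obtain ⟨x₂, hx₂, y₂, hy₂, h₂⟩ := hTop
  have hx₁' := Finset.mem_filter.1 (Finset.mem_coe.1 hx₁)
  have hy₁' := Finset.mem_filter.1 (Finset.mem_coe.1 hy₁)
  have hx₂' := Finset.mem_filter.1 (Finset.mem_coe.1 hx₂)
  have hy₂' := Finset.mem_filter.1 (Finset.mem_coe.1 hy₂)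
  refine ⟨x₁, hx₁, y₁, hy₁, x₂, hx₂, y₂, hy₂, openConnIn_mono (fun z hz => hz.1) x₁ y₁ h₁,
    openConnIn_mono (fun z hz => hz.1) x₂ y₂ h₂, fun h₁₂ => ?_⟩
  -- (2) the bottom fence meets the initial segment of the bottom crossing
  obtain ⟨s, hs, t, ht, hst⟩ := hTB
  obtain ⟨Q, hQS, hQω⟩ := exists_walk_of_mem_openConnIn hω hst
  have hs' := Finset.mem_filter.1 (Finset.mem_coe.1 hs)
  have ht' := Finset.mem_filter.1 (Finset.mem_coe.1 ht)
  have hs'' := mem_rectangle_iff.1 hs'.1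
  obtain ⟨z₁, hz₁, hP⟩ := exists_openConnIn_column hω (b : ℤ) (by rw [hx₁'.2]; positivity)
    (by rw [hy₁'.2]; exact_mod_cast (by omega : b ≤ M)) h₁
  obtain ⟨P, hPS, hPω⟩ := exists_walk_of_mem_openConnIn hω hP
  have hPbd : ∀ z ∈ P.support, (0 : ℤ) ≤ z 0 ∧ z 0 ≤ (b : ℤ) ∧ (0 : ℤ) ≤ z 1 ∧ z 1 ≤ (b : ℤ) := by
    intro z hz
    have h := hPS z hz
    simp only [Set.mem_inter_iff, Set.mem_setOf_eq, Finset.mem_coe, mem_rectangle_iff] at h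
    omega
  have hQbd : ∀ z ∈ Q.support, (0 : ℤ) ≤ z 0 ∧ z 0 ≤ (b : ℤ) ∧ (0 : ℤ) ≤ z 1 ∧ z 1 ≤ (b : ℤ) := by
    intro z hz
    have h := mem_rectangle_iff.1 (Finset.mem_coe.1 (hQS z hz))
    omega
  obtain ⟨w₁, hw₁P, hw₁Q⟩ := exists_mem_support_of_crossing P Q hPbd hQbd hx₁'.2 hz₁ hs'.2 ht'.2
  have hQrect : ∀ z ∈ Q.support, z ∈ (rectangle M (3 * b + 2) : Set (Site 2)) := by
    intro z hz
    have h := hQbd z hz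
    rw [Finset.mem_coe, mem_rectangle_iff]
    push_cast
    omega
  have c₁ : ω ∈ openConnIn (rectangle M (3 * b + 2) : Set (Site 2)) x₁ w₁ :=
    openConnIn_mono (fun z hz => hz.1.1) _ _ (mem_openConnIn_of_mem_support P hPS hPω hw₁P)
  have c₂ : ω ∈ openConnIn (rectangle M (3 * b + 2) : Set (Site 2)) s w₁ :=
    mem_openConnIn_of_mem_support Q hQrect hQω hw₁Q
  -- (3) the top fence meets the initial segment of the top crossing
  have hTB'' := relabel_mem_openCrossing (Site.shift (pt 0 (2 * (b : ℤ) + 2))) hTB'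
  have e := relabel_shift_neg_relabel_shift (-pt 0 (2 * (b : ℤ) + 2)) ω
  rw [neg_neg] at e
  rw [e] at hTB''
  obtain ⟨_, ⟨s₂, hs₂, rfl⟩, _, ⟨t₂, ht₂, rfl⟩, hst₂⟩ := hTB''
  obtain ⟨Q₂, hQ₂S, hQ₂ω⟩ := exists_walk_of_mem_openConnIn hω hst₂
  have hs₂' := Finset.mem_filter.1 (Finset.mem_coe.1 hs₂)
  have ht₂' := Finset.mem_filter.1 (Finset.mem_coe.1 ht₂)
  have ht₂'' := mem_rectangle_iff.1 ht₂'.1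
  have hQ₂bd : ∀ z ∈ Q₂.support,
      (0 : ℤ) ≤ z 0 ∧ z 0 ≤ (b : ℤ) ∧ 2 * (b : ℤ) + 2 ≤ z 1 ∧ z 1 ≤ 3 * (b : ℤ) + 2 := by
    intro z hz
    obtain ⟨z₀, hz₀, rfl⟩ := hQ₂S z hz
    have h := mem_rectangle_iff.1 (Finset.mem_coe.1 hz₀)
    simp only [Site.shift_apply, Pi.add_apply, pt, Matrix.cons_val_zero, Matrix.cons_val_one]
    omega
  obtain ⟨z₂, hz₂, hP₂⟩ := exists_openConnIn_column hω (b : ℤ) (by rw [hx₂'.2]; positivity)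
    (by rw [hy₂'.2]; exact_mod_cast (by omega : b ≤ M)) h₂
  obtain ⟨P₂, hP₂S, hP₂ω⟩ := exists_walk_of_mem_openConnIn hω hP₂
  have hP₂bd : ∀ z ∈ P₂.support,
      (0 : ℤ) ≤ z 0 ∧ z 0 ≤ (b : ℤ) ∧ 2 * (b : ℤ) + 2 ≤ z 1 ∧ z 1 ≤ 3 * (b : ℤ) + 2 := by
    intro z hz
    have h := hP₂S z hz
    simp only [Set.mem_inter_iff, Set.mem_setOf_eq, Finset.mem_coe, mem_rectangle_iff] at h
    omega
  have hs₂1 : (Site.shift (pt 0 (2 * (b : ℤ) + 2)) s₂) 1 = 2 * (b : ℤ) + 2 := by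
    simp only [Site.shift_apply, Pi.add_apply, pt, Matrix.cons_val_one, Matrix.cons_val_fin_one, hs₂'.2]
    ring
  have ht₂1 : (Site.shift (pt 0 (2 * (b : ℤ) + 2)) t₂) 1 = 3 * (b : ℤ) + 2 := by
    simp only [Site.shift_apply, Pi.add_apply, pt, Matrix.cons_val_one, Matrix.cons_val_fin_one, ht₂'.2]
    ring
  obtain ⟨w₂, hw₂P, hw₂Q⟩ := exists_mem_support_of_crossing P₂ Q₂ hP₂bd hQ₂bd hx₂'.2 hz₂ hs₂1 ht₂1
  have hQ₂rect : ∀ z ∈ Q₂.support, z ∈ (rectangle M (3 * b + 2) : Set (Site 2)) := by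
    intro z hz
    have h := hQ₂bd z hz
    rw [Finset.mem_coe, mem_rectangle_iff]
    push_cast
    omega
  have c₃ : ω ∈ openConnIn (rectangle M (3 * b + 2) : Set (Site 2)) x₂ w₂ :=
    openConnIn_mono (fun z hz => hz.1.1) _ _ (mem_openConnIn_of_mem_support P₂ hP₂S hP₂ω hw₂P)
  have c₄ : ω ∈ openConnIn (rectangle M (3 * b + 2) : Set (Site 2))
      (Site.shift (pt 0 (2 * (b : ℤ) + 2)) s₂) w₂ :=
    mem_openConnIn_of_mem_support Q₂ hQ₂rect hQ₂ω hw₂Q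
  have c₅ : ω ∈ openConnIn (rectangle M (3 * b + 2) : Set (Site 2))
      (Site.shift (pt 0 (2 * (b : ℤ) + 2)) s₂) (Site.shift (pt 0 (2 * (b : ℤ) + 2)) t₂) :=
    mem_openConnIn_of_walk Q₂ hQ₂rect hQ₂ω
  -- (4) hence an open top-bottom crossing of the rectangle
  have hTBbig : ω ∈ tbCrossing M (3 * b + 2) := by
    refine ⟨s, ?_, Site.shift (pt 0 (2 * (b : ℤ) + 2)) t₂, ?_, ?_⟩
    · rw [Finset.mem_coe, bottomSide, Finset.mem_filter, mem_rectangle_iff]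
      push_cast
      omega
    · rw [Finset.mem_coe, topSide, Finset.mem_filter, mem_rectangle_iff]
      simp only [Site.shift_apply, Pi.add_apply, pt, Matrix.cons_val_zero, Matrix.cons_val_one]
      push_cast
      omega
    · rw [openConnIn_comm] at c₁ c₄
      exact PlanarDuality.openConnIn_trans c₂ (PlanarDuality.openConnIn_trans c₁
        (PlanarDuality.openConnIn_trans h₁₂ (PlanarDuality.openConnIn_trans c₃
          (PlanarDuality.openConnIn_trans c₄ c₅))))
  -- (5) ... contradicting the dual left-right crossing of the faces
  have hLR : dualConfig ω ∈ lrCrossingAt (pt (-1) 0) (M + 1) (3 * b + 1) :=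
    openCrossing_mono (fun z hz => hz.1) subset_rfl subset_rfl hFm
  exact cg_tb_dualLR_false hω hTBbig hLR

end Summit.CriticalPhenomena.CardyFormulaZ2.Cruxes.StripClusterRates.TwoClusterRateIsStationaryGap

end
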